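import Literature.MathematicalPhysics.QuantumLattice.YangMillsHeatFlowEnergy
import Literature.MathematicalPhysics.QuantumLattice.YangMillsHeatFlowDeTurck
import Literature.MathematicalPhysics.QuantumLattice.YangMillsHeatFlowFinalTime
import HarnessLib

/-!
# The energy identity on finite slabs, hypothesis (1.1), and the named fact from Thm. 1.1 verbatim

Sorry-free progress on the named fact
`Literature.MathematicalPhysics.QuantumLattice.Waldron2019_yangMillsFlow_flatTorus` (Waldron 2019,
Cor. 1.2 with Struwe's short-time existence). `YangMillsHeatFlowEnergy.lean` proved the global
energy identity (Waldron §2 (2.5)) for immortal flows on `(0, ∞)`; the continuation argument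
applies Waldron's Thm. 1.1 to classical solutions on FINITE slabs `[0, T)`, whose hypothesis
(1.1) — `sup_{0 ≤ t < T} ∫_M |F(t)|² + ∫₀ᵀ ∫_M |D^*F|² < ∞` — "is immediate from the global
energy identity" over a closed manifold (Waldron p. 3). This file makes that sentence formal and
closes the reduction of the named fact to two parabolic theorems taken in their published form:

* `fderiv_joint_comp_add_on`, `hasDerivAt_ymDensityOfBasis_slice_on`, `…_of_flow_on`,
  `contDiffOn_ymDensityOfBasis_joint_on`, `continuousOn_energyRate_of_flow_on`,
  `norm_divCurvature_eq_of_flow_on`, `continuousOn_divergenceTerm_of_flow_on`,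
  `setIntegral_cell_divergenceTerm_eq_zero_on`, `ymEnergy_cell_sub_eq_of_flow_on` — the energy
  identity of `YangMillsHeatFlowEnergy.lean` for flows on an arbitrary OPEN TIME SET `𝒯` (same
  proofs; the identity `∫_Q e(t₂) − ∫_Q e(t₁) = −2 ∫_{t₁}^{t₂} ∫_Q ∑ⱼ ‖(div_A F)_j‖²` for
  `[t₁, t₂] ⊆ 𝒯`);
* `continuousOn_ymDensityOfBasis_joint_Ico` — joint continuity of the energy density up to
  `t = 0` for solutions smooth on `[0, T) × E`;
* `energyHypothesis_of_classical` — **hypothesis (1.1) on the flat torus**: for a classical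
  `L`-periodic `𝔲(N)`-valued solution on `[0, T)`, the energy of a period cell is bounded on
  `[0, T)` and the space-time dissipation is bounded uniformly in `0 < t₁ ≤ t₂ < T`;
* `sum_fderiv_fderiv_apply_self_eq`, `shortTime_of_semilinearHeat_coord`,
  `Waldron2019_yangMillsFlow_flatTorus_of_semilinearHeatCoord_of_thm11` — the same with the
  semilinear systems written with the coordinate Laplacian `Σ_μ ∂²/∂x_μ²` (frame independence of
  the trace of `D²u`).
* `Waldron2019_yangMillsFlow_flatTorus_of_semilinearHeat_of_thm11` — **the named fact from (i)
  local well-posedness of semilinear heat systems on the flat torus (`hSL`, Taylor *PDE III*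
  Ch. 15 §1; short-time existence for the Yang–Mills flow is PROVED from it by the DeTurck trick,
  `YangMillsHeatFlowDeTurck.lean`) and (ii) Waldron 2019, Thm. 1.1 VERBATIM (`hW`: hypothesis
  (1.1) included as a premise, conclusion "`lim_{t→T} A(t)` exists in `C^∞_loc`")** — (1.1) is
  discharged here, the smooth extension to `[0, T]` is `YangMillsHeatFlowFinalTime.lean`, Cor. 1.2
  and the flow-line packaging are `YangMillsHeatFlowContinuation.lean` / `…Proofs.lean`.

Everything is proved; no definition and no named fact is introduced.

References: A. Waldron, *Long-time existence for Yang–Mills flow*, Invent. Math. 217 (2019),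
§1 (YM), (1.1), Thm. 1.1, Cor. 1.2, p. 3; §2 (2.4)–(2.5) [Waldron2019]; M. Struwe, *The
Yang–Mills flow in four dimensions*, Calc. Var. 2 (1994), §3.2, (12), §4.1 [Struwe1994];
M. E. Taylor, *Partial Differential Equations III* (2011), Ch. 15, §1 [TaylorPDEIII2011];
S. K. Donaldson, P. B. Kronheimer, *The Geometry of Four-Manifolds* (1990), §6.3.1
[DonaldsonKronheimer1990].
-/

noncomputable section

open scoped ContDiff Topology RealInnerProductSpace Matrix
open Set Filter MeasureTheory

namespace Literature.MathematicalPhysics.QuantumLattice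

/-! ### Periodicity and the joint derivative on a time set -/

section JointPeriodic

variable {E : Type*} [NormedAddCommGroup E] [InnerProductSpace ℝ E]
variable {𝔸 : Type*} [NormedRing 𝔸] [NormedAlgebra ℝ 𝔸]

/-- **Periodicity passes to the joint derivative** at the times of an open time set `𝒯`: if every
slice `A s`, `s ∈ 𝒯`, is invariant under translation by `v`, so is the joint Fréchet derivative.
[folklore] -/
theorem fderiv_joint_comp_add_on {𝒯 : Set ℝ} (h𝒯 : IsOpen 𝒯) {A : ℝ → Connection E 𝔸} (v : E)
    (hper : ∀ s : ℝ, s ∈ 𝒯 → ∀ y : E, A s (y + v) = A s y) {s : ℝ} (hs : s ∈ 𝒯) (y : E) :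
    fderiv ℝ (fun p : ℝ × E => A p.1 p.2) (s, y + v) =
      fderiv ℝ (fun p : ℝ × E => A p.1 p.2) (s, y) := by
  set Ā := fun p : ℝ × E => A p.1 p.2 with hĀ
  have hev : (fun p : ℝ × E => Ā (p + ((0 : ℝ), v))) =ᶠ[𝓝 (s, y)] Ā := by
    have hU : 𝒯 ×ˢ (univ : Set E) ∈ 𝓝 (s, y) :=
      (h𝒯.prod isOpen_univ).mem_nhds ⟨hs, mem_univ y⟩
    filter_upwards [hU] with p hp
    obtain ⟨r, z⟩ := p
    simp only [hĀ, Prod.mk_add_mk, add_zero]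
    exact hper r hp.1 z
  rw [← hev.fderiv_eq, fderiv_comp_add_right]
  simp

end JointPeriodic

section MatrixEnergyOn

open scoped Matrix.Norms.Frobenius

attribute [local instance] frobeniusInnerProductSpace

variable {m : Type*} [Fintype m] [DecidableEq m]
variable {E : Type*} [NormedAddCommGroup E] [InnerProductSpace ℝ E]

/-- **Pointwise energy identity** (Waldron 2019 §2, (2.4)–(2.5) before integration). Let `A` be
jointly `C²` on positive space-time and `𝔲(N)`-valued at `(t, x)`, `t > 0`, and write
`Ȧ_w(y) = ∂ₜ A_w(t, y)`, `F_{ij} = F_{A(t)}(bᵢ, bⱼ)` in an orthonormal frame `b`. Then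
`d/ds|ₛ₌ₜ ∑_{i<j} ‖F_{ij}(s, x)‖² = 2 ∑ᵢⱼ ∂ᵢ⟨F_{ij}, Ȧ_j⟩(x) − 2 ∑ⱼ ⟨∑ᵢ Dᵢ F_{ij}(x), Ȧ_j(x)⟩`:
the time derivative of the energy density is a divergence minus twice the pairing of the
covariant divergence `div_A F` with `Ȧ` (which under (YM), `Ȧ = div_A F = −D^*F`, is
`−2 |D^* F|²`). Ingredients: `∂ₜ F = D Ȧ` (`hasDerivAt_curvature_slice`), the Leibniz rule for
`⟨·,·⟩` and `Ad`-invariance `⟨F, [A_i, Ȧ]⟩ = −⟨[A_i, F], Ȧ⟩` (`frobenius_inner_lie_right`).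
[cite: Waldron2019, §2 (2.4)–(2.5)] -/
theorem hasDerivAt_ymDensityOfBasis_slice_on {ι : Type*} [Fintype ι] [LinearOrder ι]
    (b : OrthonormalBasis ι ℝ E) {n : WithTop ℕ∞} {A : ℝ → Connection E (Matrix m m ℂ)}
    {𝒯 : Set ℝ} (h𝒯 : IsOpen 𝒯)
    (hA : ContDiffOn ℝ n (fun p : ℝ × E => A p.1 p.2) (𝒯 ×ˢ (univ : Set E)))
    (hn : 2 ≤ n) {t : ℝ} (ht : t ∈ 𝒯) (x : E)
    (hval : ∀ v, A t x v ∈ skewAdjoint.submodule ℝ (Matrix m m ℂ)) :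
    HasDerivAt (fun s => ymDensityOfBasis b (A s) x)
      (2 * ∑ i, ∑ j, fderiv ℝ (fun y => ⟪curvature (A t) y (b i) (b j),
          fderiv ℝ (fun p : ℝ × E => A p.1 p.2) (t, y) ((1 : ℝ), (0 : E)) (b j)⟫) x (b i) -
        2 * ∑ j, ⟪∑ i, covDeriv (A t) (fun y => curvature (A t) y (b i) (b j)) x (b i),
          fderiv ℝ (fun p : ℝ × E => A p.1 p.2) (t, x) ((1 : ℝ), (0 : E)) (b j)⟫) t := by
  set Ā := fun p : ℝ × E => A p.1 p.2 with hĀ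
  have hU : IsOpen (𝒯 ×ˢ (univ : Set E)) := h𝒯.prod isOpen_univ
  have hp : (t, x) ∈ 𝒯 ×ˢ (univ : Set E) := ⟨ht, mem_univ x⟩
  -- notation for the players at the point `x`
  set G : E → E → Matrix m m ℂ := fun y w => fderiv ℝ Ā (t, y) ((1 : ℝ), (0 : E)) w with hG
  set F : ι → ι → Matrix m m ℂ := fun i j => curvature (A t) x (b i) (b j) with hF
  set DG : ι → ι → Matrix m m ℂ := fun i j => covDeriv (A t) (fun y => G y (b j)) x (b i) with hDG
  set DF : ι → ι → Matrix m m ℂ :=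
    fun i j => covDeriv (A t) (fun y => curvature (A t) y (b i) (b j)) x (b i) with hDF
  set P : ι → ι → ℝ :=
    fun i j => fderiv ℝ (fun y => ⟪curvature (A t) y (b i) (b j), G y (b j)⟫) x (b i) with hP
  -- regularity of the slice and of the time derivative
  have hslice : ContDiff ℝ 2 (A t) := (contDiff_slice_of_contDiffOn_prod hA ht).of_le hn
  have hFdiff : ∀ i j, DifferentiableAt ℝ (fun y => curvature (A t) y (b i) (b j)) x :=
    fun i j => (differentiable_curvature_apply hslice (b i) (b j)) x
  have hGdiff : ∀ j, DifferentiableAt ℝ (fun y => G y (b j)) x := fun j =>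
    (hasFDerivAt_timeDeriv_slice hU hA hn hp (b j)).differentiableAt
  -- Step 1: `d/ds ‖F_{ij}(s)‖² = 2 ⟨F_{ij}, D_i Ȧ_j - D_j Ȧ_i⟩`
  have hFij : ∀ i j, HasDerivAt (fun s => ‖curvature (A s) x (b i) (b j)‖ ^ 2)
      (2 * ⟪F i j, DG i j - DG j i⟫) t := fun i j =>
    (hasDerivAt_curvature_slice hU hA hn hp (b i) (b j)).norm_sq
  -- Step 2: sum over the frame and halve
  have hsum : HasDerivAt (fun s => ymDensityOfBasis b (A s) x)
      ((∑ i, ∑ j, 2 * ⟪F i j, DG i j - DG j i⟫) / 2) t := by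
    have heq : (fun s => ymDensityOfBasis b (A s) x) =
        fun s => (∑ i, ∑ j, ‖curvature (A s) x (b i) (b j)‖ ^ 2) / 2 :=
      funext fun s => ymDensityOfBasis_eq_half_sum b (A s) x
    rw [heq]
    exact (HasDerivAt.fun_sum fun i _ => HasDerivAt.fun_sum fun j _ => hFij i j).div_const 2
  refine hsum.congr_deriv ?_
  -- Step 3: pointwise integration by parts in the frame direction `b i`
  have hkey : ∀ i j, ⟪F i j, DG i j⟫ = P i j - ⟪DF i j, G x (b j)⟫ := by
    intro i j
    have hleib := fderiv_inner_apply ℝ (hFdiff i j) (hGdiff j) (b i)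
    have had := frobenius_inner_lie_right (A t x (b i)) (curvature (A t) x (b i) (b j)) (G x (b j))
      (skewAdjoint.mem_iff.mp (hval (b i)))
    simp only [hF, hDG, hDF, hP, covDeriv, inner_add_right, inner_add_left]
    rw [hleib, had]
    ring
  -- Step 4: antisymmetry `F_{ij} = -F_{ji}` doubles the first pairing
  have hanti : ∑ i, ∑ j, ⟪F i j, DG j i⟫ = -∑ i, ∑ j, ⟪F i j, DG i j⟫ := by
    rw [Finset.sum_comm, ← Finset.sum_neg_distrib]
    refine Finset.sum_congr rfl fun i _ => ?_
    rw [← Finset.sum_neg_distrib]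
    refine Finset.sum_congr rfl fun j _ => ?_
    simp only [hF]
    rw [curvature_antisymm (A t) x (b j) (b i), inner_neg_left]
  -- Step 5: bookkeeping
  have hdiv : ∑ i, ∑ j, ⟪F i j, DG i j⟫ = ∑ i, ∑ j, P i j - ∑ j, ⟪∑ i, DF i j, G x (b j)⟫ := by
    simp_rw [hkey, Finset.sum_sub_distrib, sum_inner]
    rw [Finset.sum_comm (f := fun i j => ⟪DF i j, G x (b j)⟫)]
  have hfinal : (∑ i, ∑ j, 2 * ⟪F i j, DG i j - DG j i⟫) / 2 =
      ∑ i, ∑ j, ⟪F i j, DG i j⟫ - ∑ i, ∑ j, ⟪F i j, DG j i⟫ := by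
    simp only [inner_sub_right, mul_sub, Finset.sum_sub_distrib, ← Finset.mul_sum]
    ring
  rw [hfinal, hanti, hdiv]
  ring

variable [FiniteDimensional ℝ E]

/-- **Pointwise energy identity along the flow.** Under the Yang–Mills heat equation
`∂ₜ A = div_A F_A` at `(t, x)`, the time derivative of the energy density in the frame `b` is
`2 ∑ᵢⱼ ∂ᵢ⟨F_{ij}, Ȧ_j⟩(x) − 2 ∑ⱼ ‖div_A F(x)(bⱼ)‖²` — a divergence minus twice the dissipation
density `|D^*F|²`. Waldron (2019) §2, (2.4). [cite: Waldron2019, §2 (2.4)] -/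
theorem hasDerivAt_ymDensityOfBasis_of_flow_on {ι : Type*} [Fintype ι] [LinearOrder ι]
    (b : OrthonormalBasis ι ℝ E) {n : WithTop ℕ∞} {A : ℝ → Connection E (Matrix m m ℂ)}
    {𝒯 : Set ℝ} (h𝒯 : IsOpen 𝒯)
    (hA : ContDiffOn ℝ n (fun p : ℝ × E => A p.1 p.2) (𝒯 ×ˢ (univ : Set E)))
    (hn : 2 ≤ n) {t : ℝ} (ht : t ∈ 𝒯) (x : E)
    (hval : ∀ v, A t x v ∈ skewAdjoint.submodule ℝ (Matrix m m ℂ))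
    (hpde : ∀ w, deriv (fun s => A s x w) t = divCurvature (A t) x w) :
    HasDerivAt (fun s => ymDensityOfBasis b (A s) x)
      (2 * ∑ i, ∑ j, fderiv ℝ (fun y => ⟪curvature (A t) y (b i) (b j),
          fderiv ℝ (fun p : ℝ × E => A p.1 p.2) (t, y) ((1 : ℝ), (0 : E)) (b j)⟫) x (b i) -
        2 * ∑ j, ‖divCurvature (A t) x (b j)‖ ^ 2) t := by
  have hn0 : n ≠ 0 := by
    rintro rfl
    exact (not_le.mpr (by exact_mod_cast (by norm_num : (0:ℕ) < 2) : (0 : WithTop ℕ∞) < 2)) hn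
  have h := hasDerivAt_ymDensityOfBasis_slice_on b h𝒯 hA hn ht x hval
  refine h.congr_deriv ?_
  congr 2
  refine Finset.sum_congr rfl fun j _ => ?_
  have hslice : ContDiff ℝ 2 (A t) := (contDiff_slice_of_contDiffOn_prod hA ht).of_le hn
  have hG : fderiv ℝ (fun p : ℝ × E => A p.1 p.2) (t, x) ((1 : ℝ), (0 : E)) (b j) =
      divCurvature (A t) x (b j) := by
    rw [← hpde (b j)]
    exact (hasDerivAt_slice_apply (h𝒯.prod isOpen_univ) hA hn0 ⟨ht, mem_univ x⟩ (b j)).deriv.symm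
  rw [← divCurvature_eq_sum_orthonormalBasis b (A t) hslice x (b j), hG,
    real_inner_self_eq_norm_sq]

omit [FiniteDimensional ℝ E] in
/-- The energy density `(s, y) ↦ ∑_{i<j} ‖F_{ij}(s, y)‖²` of a jointly `C^n`, `2 ≤ n`,
time-dependent connection is jointly `C¹` on positive space-time. [folklore] -/
theorem contDiffOn_ymDensityOfBasis_joint_on {ι : Type*} [Fintype ι] [LinearOrder ι]
    (b : OrthonormalBasis ι ℝ E) {n : WithTop ℕ∞} {A : ℝ → Connection E (Matrix m m ℂ)}
    {𝒯 : Set ℝ} (h𝒯 : IsOpen 𝒯)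
    (hA : ContDiffOn ℝ n (fun p : ℝ × E => A p.1 p.2) (𝒯 ×ˢ (univ : Set E)))
    (hn : 2 ≤ n) :
    ContDiffOn ℝ 1 (fun p : ℝ × E => ymDensityOfBasis b (A p.1) p.2)
      (𝒯 ×ˢ (univ : Set E)) := by
  have heq : (fun p : ℝ × E => ymDensityOfBasis b (A p.1) p.2) =
      fun p => (∑ i, ∑ j, ‖curvature (A p.1) p.2 (b i) (b j)‖ ^ 2) / 2 :=
    funext fun p => ymDensityOfBasis_eq_half_sum b (A p.1) p.2
  rw [heq]
  refine ContDiffOn.div_const (ContDiffOn.sum fun i _ => ContDiffOn.sum fun j _ => ?_) 2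
  have h1 : ContDiffOn ℝ 1 (fun p : ℝ × E => curvature (A p.1) p.2 (b i) (b j))
      (𝒯 ×ˢ (univ : Set E)) :=
    contDiffOn_curvature_joint (h𝒯.prod isOpen_univ) hA
      (by rw [one_add_one_eq_two]; exact hn) (b i) (b j)
  exact h1.norm_sq ℝ

/-- **Joint continuity of the dissipative energy rate.** Along a jointly `C^n` (`2 ≤ n`),
`𝔲(N)`-valued solution of the Yang–Mills heat equation on positive space-time, the rate
`2 ∑ᵢⱼ ∂ᵢ⟨F_{ij}, Ȧ_j⟩ − 2 ∑ⱼ ‖div_A F(bⱼ)‖²` is the partial time derivative of the `C¹` energy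
density, hence jointly continuous. [folklore] -/
theorem continuousOn_energyRate_of_flow_on {ι : Type*} [Fintype ι] [LinearOrder ι]
    (b : OrthonormalBasis ι ℝ E) {n : WithTop ℕ∞} {A : ℝ → Connection E (Matrix m m ℂ)}
    {𝒯 : Set ℝ} (h𝒯 : IsOpen 𝒯)
    (hA : ContDiffOn ℝ n (fun p : ℝ × E => A p.1 p.2) (𝒯 ×ˢ (univ : Set E)))
    (hn : 2 ≤ n)
    (hval : ∀ ⦃s : ℝ⦄, s ∈ 𝒯 → (A s).IsValuedIn (skewAdjoint.submodule ℝ (Matrix m m ℂ)))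
    (hpde : ∀ ⦃s : ℝ⦄, s ∈ 𝒯 → ∀ y w, deriv (fun s' => A s' y w) s = divCurvature (A s) y w) :
    ContinuousOn (fun p : ℝ × E =>
      2 * ∑ i, ∑ j, fderiv ℝ (fun y => ⟪curvature (A p.1) y (b i) (b j),
          fderiv ℝ (fun q : ℝ × E => A q.1 q.2) (p.1, y) ((1 : ℝ), (0 : E)) (b j)⟫) p.2 (b i) -
        2 * ∑ j, ‖divCurvature (A p.1) p.2 (b j)‖ ^ 2)
      (𝒯 ×ˢ (univ : Set E)) := by
  have hU : IsOpen (𝒯 ×ˢ (univ : Set E)) := h𝒯.prod isOpen_univ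
  set e : ℝ × E → ℝ := fun p => ymDensityOfBasis b (A p.1) p.2 with he
  have he1 : ContDiffOn ℝ 1 e (𝒯 ×ˢ (univ : Set E)) :=
    contDiffOn_ymDensityOfBasis_joint_on b h𝒯 hA hn
  -- the rate is the partial time derivative of `e`
  have hrate : ∀ p ∈ 𝒯 ×ˢ (univ : Set E),
      2 * ∑ i, ∑ j, fderiv ℝ (fun y => ⟪curvature (A p.1) y (b i) (b j),
          fderiv ℝ (fun q : ℝ × E => A q.1 q.2) (p.1, y) ((1 : ℝ), (0 : E)) (b j)⟫) p.2 (b i) -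
        2 * ∑ j, ‖divCurvature (A p.1) p.2 (b j)‖ ^ 2 = fderiv ℝ e p ((1 : ℝ), (0 : E)) := by
    rintro ⟨s, y⟩ hp
    have h1 := hasDerivAt_ymDensityOfBasis_of_flow_on b h𝒯 hA hn hp.1 y (hval hp.1 y) (hpde hp.1 y)
    have h2 : HasDerivAt (fun s' => e (s', y)) (fderiv ℝ e (s, y) ((1 : ℝ), (0 : E))) s :=
      hasDerivAt_curry_of_contDiffOn hU he1 one_ne_zero hp
    exact h1.unique h2
  have hcont : ContinuousOn (fun p : ℝ × E => fderiv ℝ e p ((1 : ℝ), (0 : E)))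
      (𝒯 ×ˢ (univ : Set E)) :=
    ((ContinuousLinearMap.apply ℝ ℝ ((1 : ℝ), (0 : E))).continuous).comp_continuousOn
      (he1.continuousOn_fderiv_of_isOpen hU le_rfl)
  exact hcont.congr hrate

/-- Under the flow equation, `div_A F` is the time derivative read off the joint map, hence the
dissipation density `∑ⱼ ‖div_A F(bⱼ)‖²` is `∑ⱼ ‖DĀ[(1,0)] bⱼ‖²`. [folklore] -/
theorem norm_divCurvature_eq_of_flow_on {n : WithTop ℕ∞} {A : ℝ → Connection E (Matrix m m ℂ)}
    {𝒯 : Set ℝ} (h𝒯 : IsOpen 𝒯)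
    (hA : ContDiffOn ℝ n (fun p : ℝ × E => A p.1 p.2) (𝒯 ×ˢ (univ : Set E)))
    (hn : n ≠ 0) {s : ℝ} (hs : s ∈ 𝒯) (y w : E)
    (hpde : deriv (fun s' => A s' y w) s = divCurvature (A s) y w) :
    divCurvature (A s) y w =
      fderiv ℝ (fun p : ℝ × E => A p.1 p.2) (s, y) ((1 : ℝ), (0 : E)) w := by
  rw [← hpde]
  exact (hasDerivAt_slice_apply (h𝒯.prod isOpen_univ) hA hn ⟨hs, mem_univ y⟩ w).deriv

/-- **Joint continuity of the divergence term** `∑ᵢⱼ ∂ᵢ⟨F_{ij}, Ȧ_j⟩` along a `𝔲(N)`-valued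
solution (it is half the energy rate plus the dissipation `∑ⱼ ‖Ȧ_j‖²`). [folklore] -/
theorem continuousOn_divergenceTerm_of_flow_on {ι : Type*} [Fintype ι] [LinearOrder ι]
    (b : OrthonormalBasis ι ℝ E) {n : WithTop ℕ∞} {A : ℝ → Connection E (Matrix m m ℂ)}
    {𝒯 : Set ℝ} (h𝒯 : IsOpen 𝒯)
    (hA : ContDiffOn ℝ n (fun p : ℝ × E => A p.1 p.2) (𝒯 ×ˢ (univ : Set E)))
    (hn : 2 ≤ n)
    (hval : ∀ ⦃s : ℝ⦄, s ∈ 𝒯 → (A s).IsValuedIn (skewAdjoint.submodule ℝ (Matrix m m ℂ)))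
    (hpde : ∀ ⦃s : ℝ⦄, s ∈ 𝒯 → ∀ y w, deriv (fun s' => A s' y w) s = divCurvature (A s) y w) :
    ContinuousOn (fun p : ℝ × E =>
      ∑ i, ∑ j, fderiv ℝ (fun y => ⟪curvature (A p.1) y (b i) (b j),
          fderiv ℝ (fun q : ℝ × E => A q.1 q.2) (p.1, y) ((1 : ℝ), (0 : E)) (b j)⟫) p.2 (b i))
      (𝒯 ×ˢ (univ : Set E)) := by
  have hU : IsOpen (𝒯 ×ˢ (univ : Set E)) := h𝒯.prod isOpen_univ
  have hn0 : n ≠ 0 := by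
    rintro rfl
    exact (not_le.mpr (by exact_mod_cast (by norm_num : (0:ℕ) < 2) : (0 : WithTop ℕ∞) < 2)) hn
  have hrate := continuousOn_energyRate_of_flow_on b h𝒯 hA hn hval hpde
  -- the dissipation in terms of the joint derivative is continuous
  have hG : ContinuousOn (fun p : ℝ × E =>
      ∑ j, ‖fderiv ℝ (fun q : ℝ × E => A q.1 q.2) p ((1 : ℝ), (0 : E)) (b j)‖ ^ 2)
      (𝒯 ×ˢ (univ : Set E)) := by
    have h1 := hA.continuousOn_fderiv_of_isOpen hU (ENat.one_le_iff_ne_zero_withTop.mpr hn0)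
    refine continuousOn_finsetSum _ fun j _ => ?_
    exact (continuous_norm.comp_continuousOn
      ((h1.clm_apply continuousOn_const).clm_apply continuousOn_const)).pow 2
  refine ((continuousOn_const (c := (2⁻¹ : ℝ))).mul
    (hrate.add ((continuousOn_const (c := (2 : ℝ))).mul hG))).congr ?_
  rintro ⟨s, y⟩ hp
  have hD : ∀ j, divCurvature (A s) y (b j) =
      fderiv ℝ (fun q : ℝ × E => A q.1 q.2) (s, y) ((1 : ℝ), (0 : E)) (b j) := fun j =>
    norm_divCurvature_eq_of_flow_on h𝒯 hA hn0 hp.1 y (b j) (hpde hp.1 y (b j))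
  simp only [Pi.mul_apply, Pi.add_apply, ← hD]
  ring


end MatrixEnergyOn

section TorusEnergyOn

open scoped Matrix.Norms.Frobenius

attribute [local instance] frobeniusInnerProductSpace

variable {m : Type*} [Fintype m] [DecidableEq m] {k : ℕ}

/-- **The divergence term integrates to zero over a period cell.** For an `L`-periodic (in every
lattice direction), jointly `C²` time-dependent connection on `ℝ^{k+1}` whose divergence term is
continuous, `∫_{cell} ∑ᵢⱼ ∂ᵢ⟨F_{ij}, Ȧ_j⟩ = 0` at each positive time: the field
`Wᵢ = ∑ⱼ ⟨F_{ij}, Ȧ_j⟩` is periodic and the face fluxes cancel (Stokes on the flat torus).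
[folklore] -/
theorem setIntegral_cell_divergenceTerm_eq_zero_on {n : WithTop ℕ∞} {L : ℝ} (hL : 0 ≤ L)
    (a : Fin (k + 1) → ℝ) {A : ℝ → Connection (EuclideanSpace ℝ (Fin (k + 1))) (Matrix m m ℂ)}
    {𝒯 : Set ℝ} (h𝒯 : IsOpen 𝒯)
    (hA : ContDiffOn ℝ n (fun p : ℝ × _ => A p.1 p.2) (𝒯 ×ˢ univ))
    (hn : 2 ≤ n) {s : ℝ} (hs : s ∈ 𝒯)
    (hper : ∀ s : ℝ, s ∈ 𝒯 → (A s).IsLatticePeriodic L)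
    (hcont : Continuous fun y : EuclideanSpace ℝ (Fin (k + 1)) =>
      ∑ i, ∑ j, fderiv ℝ (fun z => ⟪curvature (A s) z (EuclideanSpace.basisFun _ ℝ i)
          (EuclideanSpace.basisFun _ ℝ j),
        fderiv ℝ (fun q : ℝ × _ => A q.1 q.2) (s, z) ((1 : ℝ), 0)
          (EuclideanSpace.basisFun _ ℝ j)⟫) y (EuclideanSpace.basisFun _ ℝ i)) :
    ∫ y in {y | WithLp.ofLp y ∈ Icc a (fun i => a i + L)},
      ∑ i, ∑ j, fderiv ℝ (fun z => ⟪curvature (A s) z (EuclideanSpace.basisFun _ ℝ i)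
          (EuclideanSpace.basisFun _ ℝ j),
        fderiv ℝ (fun q : ℝ × _ => A q.1 q.2) (s, z) ((1 : ℝ), 0)
          (EuclideanSpace.basisFun _ ℝ j)⟫) y (EuclideanSpace.basisFun _ ℝ i) = 0 := by
  set 𝔟 := EuclideanSpace.basisFun (Fin (k + 1)) ℝ with h𝔟
  have hU : IsOpen (𝒯 ×ˢ (univ : Set (EuclideanSpace ℝ (Fin (k + 1))))) :=
    h𝒯.prod isOpen_univ
  have hn0 : n ≠ 0 := by
    rintro rfl
    exact (not_le.mpr (by exact_mod_cast (by norm_num : (0:ℕ) < 2) : (0 : WithTop ℕ∞) < 2)) hn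
  -- the players at time `s`
  set G : (EuclideanSpace ℝ (Fin (k + 1))) → (EuclideanSpace ℝ (Fin (k + 1))) → Matrix m m ℂ :=
    fun y w => fderiv ℝ (fun q : ℝ × _ => A q.1 q.2) (s, y) ((1 : ℝ), 0) w with hG
  set Φ : Fin (k + 1) → Fin (k + 1) → (EuclideanSpace ℝ (Fin (k + 1))) → ℝ :=
    fun i j y => ⟪curvature (A s) y (𝔟 i) (𝔟 j), G y (𝔟 j)⟫ with hΦ
  have hslice : ContDiff ℝ 2 (A s) := (contDiff_slice_of_contDiffOn_prod hA hs).of_le hn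
  have hFd : ∀ i j, Differentiable ℝ fun y => curvature (A s) y (𝔟 i) (𝔟 j) := fun i j =>
    differentiable_curvature_apply hslice _ _
  have hGd : ∀ j, Differentiable ℝ fun y => G y (𝔟 j) := fun j y =>
    (hasFDerivAt_timeDeriv_slice hU hA hn ⟨hs, mem_univ y⟩ (𝔟 j)).differentiableAt
  have hΦd : ∀ i j, Differentiable ℝ (Φ i j) := fun i j => (hFd i j).inner ℝ (hGd j)
  -- the vector field `W i = ∑ j Φ i j` on `EuclideanSpace` and in coordinates
  set W : (EuclideanSpace ℝ (Fin (k + 1))) → Fin (k + 1) → ℝ := fun y i => ∑ j, Φ i j y with hW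
  have hWd : Differentiable ℝ W :=
    differentiable_pi.mpr fun i => Differentiable.fun_sum fun j _ => hΦd i j
  set w : (Fin (k + 1) → ℝ) → Fin (k + 1) → ℝ := fun z => W (WithLp.toLp 2 z) with hw
  have htoLp : Differentiable ℝ
      (fun z : Fin (k + 1) → ℝ => (WithLp.toLp 2 z : EuclideanSpace ℝ (Fin (k + 1)))) :=
    (PiLp.continuousLinearEquiv 2 ℝ (fun _ : Fin (k + 1) => ℝ)).symm.differentiable
  have hwd : Differentiable ℝ w := hWd.comp htoLp
  -- periodicity
  have hperA : ∀ i, ∀ r : ℝ, r ∈ 𝒯 → ∀ y : EuclideanSpace ℝ (Fin (k + 1)),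
      A r (y + EuclideanSpace.single i L) = A r y :=
    fun i r hr y => hper r hr y i
  have hΦper : ∀ i j l y, Φ i j (y + EuclideanSpace.single l L) = Φ i j y := by
    intro i j l y
    simp only [hΦ, hG, curvature_comp_add _ (hperA l s hs)]
    rw [fderiv_joint_comp_add_on h𝒯 _ (hperA l) hs]
  have hwper : ∀ z l, w (z + Pi.single l L) = w z := by
    intro z l
    simp only [hw, hW, WithLp.toLp_add, PiLp.toLp_single]
    funext i
    exact Finset.sum_congr rfl fun j _ => hΦper i j l _
  -- the divergence of `w` in coordinates is the divergence term
  set eqv := (PiLp.continuousLinearEquiv 2 ℝ (fun _ : Fin (k + 1) => ℝ)).symm with heqv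
  have hdiv : ∀ z : Fin (k + 1) → ℝ, ∑ i, fderiv ℝ w z (Pi.single i 1) i =
      ∑ i, ∑ j, fderiv ℝ (Φ i j) (WithLp.toLp 2 z) (𝔟 i) := by
    intro z
    refine Finset.sum_congr rfl fun i _ => ?_
    have hc : HasFDerivAt (fun z : Fin (k + 1) → ℝ => W (WithLp.toLp 2 z))
        ((fderiv ℝ W (WithLp.toLp 2 z)).comp
          (eqv : (Fin (k + 1) → ℝ) →L[ℝ] (EuclideanSpace ℝ (Fin (k + 1))))) z :=
      (hWd _).hasFDerivAt.comp z eqv.hasFDerivAt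
    have hWi : fderiv ℝ W (WithLp.toLp 2 z) = ContinuousLinearMap.pi fun i =>
        fderiv ℝ (fun y => ∑ j, Φ i j y) (WithLp.toLp 2 z) :=
      fderiv_pi fun i => (Differentiable.fun_sum fun j _ => hΦd i j) _
    rw [hw, hc.fderiv, ContinuousLinearMap.comp_apply, hWi, ContinuousLinearMap.pi_apply,
      fderiv_fun_sum fun j _ => (hΦd i j _)]
    simp [heqv, h𝔟, EuclideanSpace.basisFun_apply]
  -- integrability of the divergence on the period box
  have hint : IntegrableOn (fun z => ∑ i, fderiv ℝ w z (Pi.single i 1) i)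
      (Icc a (fun i => a i + L)) := by
    have hc : Continuous fun z : Fin (k + 1) → ℝ =>
        ∑ i, ∑ j, fderiv ℝ (Φ i j) (WithLp.toLp 2 z) (𝔟 i) := hcont.comp eqv.continuous
    rw [show (fun z => ∑ i, fderiv ℝ w z (Pi.single i 1) i) =
      fun z : Fin (k + 1) → ℝ => ∑ i, ∑ j, fderiv ℝ (Φ i j) (WithLp.toLp 2 z) (𝔟 i) from
      funext hdiv]
    exact hc.continuousOn.integrableOn_compact isCompact_Icc
  -- Stokes on the torus, in coordinates
  have hper0 := Literature.Analysis.Calculus.integral_divergence_eq_zero_of_periodic hL a w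
    (fun z => fderiv ℝ w z) hwd.continuous (fun z => (hwd z).hasFDerivAt) hwper hint
  simp_rw [hdiv] at hper0
  -- transport back to `EuclideanSpace`
  have htrans := (PiLp.volume_preserving_ofLp (Fin (k + 1))).setIntegral_preimage_emb
    (MeasurableEquiv.toLp 2 (Fin (k + 1) → ℝ)).symm.measurableEmbedding
    (fun z => ∑ i, ∑ j, fderiv ℝ (Φ i j) (WithLp.toLp 2 z) (𝔟 i)) (Icc a (fun i => a i + L))
  simp only [WithLp.toLp_ofLp] at htrans
  rw [hper0] at htrans
  exact htrans

/-- **Global energy identity for the Yang–Mills heat flow on the flat torus** (step (S2) of the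
proof of Waldron's Cor. 1.2: "over a closed manifold, (1.1) is immediate from the global energy
identity"). Let `A` be jointly `C^n` (`2 ≤ n`) on positive space-time, `L`-periodic in every
lattice direction, `𝔲(N)`-valued, and solve `∂ₜ A = div_A F_A = −D_A^* F_A` on `(0, ∞) × ℝ^{k+1}`.
Then on every period cell `Q = a + [0, L]^{k+1}` and for `0 < t₁ ≤ t₂`,
`∫_Q ∑_{i<j} ‖F_{ij}(t₂)‖² − ∫_Q ∑_{i<j} ‖F_{ij}(t₁)‖² = −2 ∫_{t₁}^{t₂} ∫_Q ∑ⱼ ‖(div_A F)_j‖²`,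
i.e. `YM(t₂) + ∫∫ |D^*F|² = YM(t₁)` with `YM = ½ ∫ |F|²` (Waldron 2019 (2.5) with `χ ≡ 1`;
Struwe 1994, §3.2, (12)). Proof: the pointwise identity `hasDerivAt_ymDensityOfBasis_of_flow_on`,
Stokes on the torus for the divergence term (`setIntegral_cell_divergenceTerm_eq_zero_on`), the
fundamental theorem of calculus in `t` and Fubini on `Q × [t₁, t₂]`.
[cite: Waldron2019, §2 (2.5)] -/
theorem ymEnergy_cell_sub_eq_of_flow_on {n : WithTop ℕ∞} {L : ℝ} (hL : 0 ≤ L)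
    (a : Fin (k + 1) → ℝ) {A : ℝ → Connection (EuclideanSpace ℝ (Fin (k + 1))) (Matrix m m ℂ)}
    {𝒯 : Set ℝ} (h𝒯 : IsOpen 𝒯)
    (hA : ContDiffOn ℝ n (fun p : ℝ × _ => A p.1 p.2) (𝒯 ×ˢ univ))
    (hn : 2 ≤ n) (hper : ∀ s : ℝ, s ∈ 𝒯 → (A s).IsLatticePeriodic L)
    (hval : ∀ ⦃s : ℝ⦄, s ∈ 𝒯 → (A s).IsValuedIn (skewAdjoint.submodule ℝ (Matrix m m ℂ)))
    (hpde : ∀ ⦃s : ℝ⦄, s ∈ 𝒯 → ∀ y w, deriv (fun s' => A s' y w) s = divCurvature (A s) y w)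
    {t₁ t₂ : ℝ} (h12 : t₁ ≤ t₂) (hsub : Icc t₁ t₂ ⊆ 𝒯) :
    (∫ y in {y | WithLp.ofLp y ∈ Icc a (fun i => a i + L)},
        ymDensityOfBasis (EuclideanSpace.basisFun _ ℝ) (A t₂) y) -
      (∫ y in {y | WithLp.ofLp y ∈ Icc a (fun i => a i + L)},
        ymDensityOfBasis (EuclideanSpace.basisFun _ ℝ) (A t₁) y) =
      -2 * ∫ s in t₁..t₂,
        ∫ y in {y | WithLp.ofLp y ∈ Icc a (fun i => a i + L)},
          ∑ j, ‖divCurvature (A s) y (EuclideanSpace.basisFun _ ℝ j)‖ ^ 2 := by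
  set 𝔟 := EuclideanSpace.basisFun (Fin (k + 1)) ℝ with h𝔟
  set Q : Set (EuclideanSpace ℝ (Fin (k + 1))) :=
    {y | (WithLp.ofLp y : Fin (k + 1) → ℝ) ∈ Icc a (fun i => a i + L)}
    with hQ
  set U : Set (ℝ × (EuclideanSpace ℝ (Fin (k + 1)))) := 𝒯 ×ˢ univ with hU'
  have hU : IsOpen U := h𝒯.prod isOpen_univ
  -- the three densities on space-time
  set e : ℝ × (EuclideanSpace ℝ (Fin (k + 1))) → ℝ :=
    fun p => ymDensityOfBasis 𝔟 (A p.1) p.2 with he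
  set Pt : ℝ × (EuclideanSpace ℝ (Fin (k + 1))) → ℝ := fun p => ∑ i, ∑ j,
    fderiv ℝ (fun y => ⟪curvature (A p.1) y (𝔟 i) (𝔟 j),
      fderiv ℝ (fun q : ℝ × _ => A q.1 q.2) (p.1, y) ((1 : ℝ), 0) (𝔟 j)⟫) p.2 (𝔟 i) with hPt
  set Dis : ℝ × (EuclideanSpace ℝ (Fin (k + 1))) → ℝ :=
    fun p => ∑ j, ‖divCurvature (A p.1) p.2 (𝔟 j)‖ ^ 2 with hDis
  set rate : ℝ × (EuclideanSpace ℝ (Fin (k + 1))) → ℝ := fun p => 2 * Pt p - 2 * Dis p with hrate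
  -- continuity on positive space-time
  have hrate_c : ContinuousOn rate U := continuousOn_energyRate_of_flow_on 𝔟 h𝒯 hA hn hval hpde
  have hPt_c : ContinuousOn Pt U := continuousOn_divergenceTerm_of_flow_on 𝔟 h𝒯 hA hn hval hpde
  have hDis_c : ContinuousOn Dis U := by
    refine ((hPt_c.sub ((continuousOn_const (c := (2⁻¹ : ℝ))).mul hrate_c))).congr ?_
    intro p _
    simp only [hrate, Pi.sub_apply, Pi.mul_apply]
    ring
  have he_c : ContinuousOn e U := (contDiffOn_ymDensityOfBasis_joint_on 𝔟 h𝒯 hA hn).continuousOn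
  -- the derivative in time, at every point of positive space-time
  have hderiv : ∀ p ∈ U, HasDerivAt (fun s => e (s, p.2)) (rate p) p.1 := by
    rintro ⟨s, y⟩ hp
    exact hasDerivAt_ymDensityOfBasis_of_flow_on 𝔟 h𝒯 hA hn hp.1 y (hval hp.1 y) (hpde hp.1 y)
  -- the cell is compact and measurable
  have hQc : IsCompact Q :=
    (PiLp.continuousLinearEquiv 2 ℝ (fun _ : Fin (k + 1) => ℝ)).toHomeomorph.isCompact_preimage.mpr
      isCompact_Icc
  have hQm : MeasurableSet Q := hQc.isClosed.measurableSet
  -- slices in `y` at a fixed positive time, and in `s` at a fixed point, are continuous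
  have hslice_y : ∀ {f : ℝ × (EuclideanSpace ℝ (Fin (k + 1))) → ℝ}, ContinuousOn f U →
      ∀ {s : ℝ}, s ∈ 𝒯 →
      Continuous fun y => f (s, y) := fun hf s hs =>
    continuousOn_univ.mp (hf.comp (continuous_const.prodMk continuous_id).continuousOn
      fun y _ => ⟨hs, mem_univ y⟩)
  have hslice_s : ∀ {f : ℝ × (EuclideanSpace ℝ (Fin (k + 1))) → ℝ}, ContinuousOn f U → ∀ y,
      ContinuousOn (fun s => f (s, y)) (Icc t₁ t₂) := fun hf y =>
    hf.comp (continuous_id.prodMk continuous_const).continuousOn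
      fun s hs => ⟨hsub hs, mem_univ y⟩
  -- Step 1: fundamental theorem of calculus in time, pointwise in `y`
  have hFTC : ∀ y, ∫ s in t₁..t₂, rate (s, y) = e (t₂, y) - e (t₁, y) := by
    intro y
    refine intervalIntegral.integral_eq_sub_of_hasDerivAt (f := fun s => e (s, y))
      (f' := fun s => rate (s, y)) (fun s hs => ?_)
      ((hslice_s hrate_c y).intervalIntegrable_of_Icc h12)
    rw [uIcc_of_le h12] at hs
    exact hderiv (s, y) ⟨hsub hs, mem_univ y⟩
  -- Step 2: integrate over the cell
  have hint_e : ∀ {s : ℝ}, s ∈ 𝒯 → IntegrableOn (fun y => e (s, y)) Q :=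
    fun hs => (hslice_y he_c hs).continuousOn.integrableOn_compact hQc
  have hLHS : (∫ y in Q, e (t₂, y)) - ∫ y in Q, e (t₁, y) =
      ∫ y in Q, ∫ s in t₁..t₂, rate (s, y) := by
    rw [← integral_sub (hint_e (hsub ⟨h12, le_rfl⟩)) (hint_e (hsub ⟨le_rfl, h12⟩))]
    exact setIntegral_congr_fun hQm fun y _ => (hFTC y).symm
  -- Step 3: Fubini on `Q × [t₁, t₂]`
  have hprod_int : Integrable
      (Function.uncurry fun (y : EuclideanSpace ℝ (Fin (k + 1))) (s : ℝ) => rate (s, y))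
      ((volume.restrict Q).prod (volume.restrict (Ioc t₁ t₂))) := by
    have hc : ContinuousOn
        (Function.uncurry fun (y : EuclideanSpace ℝ (Fin (k + 1))) (s : ℝ) => rate (s, y))
        (Q ×ˢ Icc t₁ t₂) := by
      refine hrate_c.comp continuous_swap.continuousOn ?_
      rintro ⟨y, s⟩ ⟨_, hs⟩
      exact ⟨hsub hs, mem_univ y⟩
    have hi : IntegrableOn
        (Function.uncurry fun (y : EuclideanSpace ℝ (Fin (k + 1))) (s : ℝ) => rate (s, y))
        (Q ×ˢ Ioc t₁ t₂) (volume.prod volume) := by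
      rw [← Measure.volume_eq_prod]
      exact (hc.integrableOn_compact (hQc.prod isCompact_Icc)).mono_set
        (prod_mono Subset.rfl Ioc_subset_Icc_self)
    rw [Measure.prod_restrict]
    exact hi
  have hswap : ∫ y in Q, ∫ s in t₁..t₂, rate (s, y) = ∫ s in t₁..t₂, ∫ y in Q, rate (s, y) := by
    simp_rw [intervalIntegral.integral_of_le h12]
    exact integral_integral_swap hprod_int
  -- Step 4: at each time, the divergence term integrates to zero over the cell
  have hinner : ∀ s ∈ Ioc t₁ t₂, ∫ y in Q, rate (s, y) = -2 * ∫ y in Q, Dis (s, y) := by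
    intro s hs
    have hs0 : s ∈ 𝒯 := hsub ⟨hs.1.le, hs.2⟩
    have hP0 : ∫ y in Q, Pt (s, y) = 0 :=
      setIntegral_cell_divergenceTerm_eq_zero_on hL a h𝒯 hA hn hs0 hper (hslice_y hPt_c hs0)
    have hiP : IntegrableOn (fun y => Pt (s, y)) Q :=
      (hslice_y hPt_c hs0).continuousOn.integrableOn_compact hQc
    have hiD : IntegrableOn (fun y => Dis (s, y)) Q :=
      (hslice_y hDis_c hs0).continuousOn.integrableOn_compact hQc
    simp only [hrate]
    rw [integral_sub (hiP.const_mul 2) (hiD.const_mul 2), integral_const_mul, integral_const_mul,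
      hP0]
    ring
  have hRHS : ∫ s in t₁..t₂, ∫ y in Q, rate (s, y) = -2 * ∫ s in t₁..t₂, ∫ y in Q, Dis (s, y) := by
    rw [intervalIntegral.integral_of_le h12, intervalIntegral.integral_of_le h12,
      ← integral_const_mul]
    exact setIntegral_congr_fun measurableSet_Ioc hinner
  -- assemble
  rw [hLHS, hswap, hRHS]

/-- **Joint continuity of the energy density up to the initial time.** For a time-dependent
connection jointly `C^∞` on `[0, T) × E` (one-sided at `t = 0`), the energy density
`(t, y) ↦ ∑_{i<j} ‖F_{ij}(t, y)‖²` is jointly continuous on `[0, T) × E`. [folklore] -/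
theorem continuousOn_ymDensityOfBasis_joint_Ico {ι : Type*} [Fintype ι] [LinearOrder ι]
    {E : Type*} [NormedAddCommGroup E] [InnerProductSpace ℝ E] [FiniteDimensional ℝ E]
    (b : OrthonormalBasis ι ℝ E) {T : ℝ} {A : ℝ → Connection E (Matrix m m ℂ)}
    (hA : ContDiffOn ℝ ∞ (fun p : ℝ × E => A p.1 p.2) (Ico 0 T ×ˢ (univ : Set E))) :
    ContinuousOn (fun p : ℝ × E => ymDensityOfBasis b (A p.1) p.2) (Ico 0 T ×ˢ (univ : Set E)) := by
  have hJ : ContinuousOn (fun p : ℝ × E => fderiv ℝ (A p.1) p.2) (Ico 0 T ×ˢ (univ : Set E)) := by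
    have h := (contDiffOn_fderiv_tslice (uniqueDiffOn_Ico 0 T) (contDiffOn_swap_iff.2 hA)).continuousOn
    have h' := h.comp continuous_swap.continuousOn (s := Ico 0 T ×ˢ (univ : Set E))
      (fun p hp => ⟨mem_univ _, hp.1⟩)
    exact h'
  have hA0 : ContinuousOn (fun p : ℝ × E => A p.1 p.2) (Ico 0 T ×ˢ (univ : Set E)) := hA.continuousOn
  have heq : EqOn (fun p : ℝ × E => ymDensityOfBasis b (A p.1) p.2)
      (fun p => (∑ i, ∑ j, ‖fderiv ℝ (A p.1) p.2 (b i) (b j) - fderiv ℝ (A p.1) p.2 (b j) (b i) +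
        (A p.1 p.2 (b i) * A p.1 p.2 (b j) - A p.1 p.2 (b j) * A p.1 p.2 (b i))‖ ^ 2) / 2)
      (Ico 0 T ×ˢ (univ : Set E)) := by
    rintro ⟨t, y⟩ ⟨ht, -⟩
    have hd : DifferentiableAt ℝ (A t) y :=
      (contDiff_slice_of_contDiffOn_prod hA ht).differentiable (by simp) y
    simp only [ymDensityOfBasis_eq_half_sum b (A t) y, curvature_eq_of_differentiableAt (A t) hd]
  refine ContinuousOn.congr ?_ heq
  refine ContinuousOn.div_const (continuousOn_finsetSum _ fun i _ =>
    continuousOn_finsetSum _ fun j _ => ?_) 2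
  refine (continuous_norm.comp_continuousOn ?_).pow 2
  have hJij : ∀ u w : E, ContinuousOn (fun p : ℝ × E => fderiv ℝ (A p.1) p.2 u w)
      (Ico 0 T ×ˢ (univ : Set E)) := fun u w =>
    (hJ.clm_apply continuousOn_const).clm_apply continuousOn_const
  have hAij : ∀ w : E, ContinuousOn (fun p : ℝ × E => A p.1 p.2 w) (Ico 0 T ×ˢ (univ : Set E)) :=
    fun w => hA0.clm_apply continuousOn_const
  exact ((hJij (b i) (b j)).sub (hJij (b j) (b i))).add
    (((hAij (b i)).mul (hAij (b j))).sub ((hAij (b j)).mul (hAij (b i))))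

/-- **Hypothesis (1.1) of Waldron's Thm. 1.1 on the flat torus** ("Over a closed manifold, (1.1)
is immediate from the global energy identity", Waldron 2019 p. 3), for classical solutions on a
finite slab: if `A` is jointly smooth on `[0, T) × ℝ^{k+1}`, `L`-periodic, `𝔲(N)`-valued and
solves the Yang–Mills heat flow on `(0, T)`, then the energy of a period cell is bounded on
`[0, T)` (by continuity on `[0, T/2]` and monotonicity afterwards) and the space-time dissipation
`2 ∫_{t₁}^{t₂} ∫_Q ∑ⱼ ‖(div_A F)_j‖²` is bounded uniformly in `0 < t₁ ≤ t₂ < T` (by the energy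
identity `ymEnergy_cell_sub_eq_of_flow_on`). [cite: Waldron2019, §1 (1.1), §2 (2.5), p. 3] -/
theorem energyHypothesis_of_classical {L : ℝ} (hL : 0 ≤ L) (a : Fin (k + 1) → ℝ) {T : ℝ} (hT : 0 < T)
    {A : ℝ → Connection (EuclideanSpace ℝ (Fin (k + 1))) (Matrix m m ℂ)}
    (hA : ContDiffOn ℝ ∞ (fun p : ℝ × _ => A p.1 p.2) (Ico 0 T ×ˢ univ))
    (hper : ∀ t : ℝ, 0 ≤ t → t < T → (A t).IsLatticePeriodic L)
    (hval : ∀ t : ℝ, 0 < t → t < T → (A t).IsValuedIn (skewAdjoint.submodule ℝ (Matrix m m ℂ)))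
    (hpde : ∀ t : ℝ, 0 < t → t < T → ∀ y w,
      deriv (fun s => A s y w) t = divCurvature (A t) y w) :
    (∃ C : ℝ, ∀ t ∈ Ico 0 T, ∫ y in {y | WithLp.ofLp y ∈ Icc a (fun i => a i + L)},
        ymDensityOfBasis (EuclideanSpace.basisFun _ ℝ) (A t) y ≤ C) ∧
    ∃ C : ℝ, ∀ t₁ t₂ : ℝ, 0 < t₁ → t₁ ≤ t₂ → t₂ < T →
      2 * ∫ s in t₁..t₂, ∫ y in {y | WithLp.ofLp y ∈ Icc a (fun i => a i + L)},
        ∑ j, ‖divCurvature (A s) y (EuclideanSpace.basisFun _ ℝ j)‖ ^ 2 ≤ C := by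
  set 𝔟 := EuclideanSpace.basisFun (Fin (k + 1)) ℝ with h𝔟
  set Q : Set (EuclideanSpace ℝ (Fin (k + 1))) :=
    {y | (WithLp.ofLp y : Fin (k + 1) → ℝ) ∈ Icc a (fun i => a i + L)} with hQ
  set En : ℝ → ℝ := fun t => ∫ y in Q, ymDensityOfBasis 𝔟 (A t) y with hEn
  -- the energy identity on `(0, T)`
  have hA' : ContDiffOn ℝ ∞ (fun p : ℝ × _ => A p.1 p.2) (Ioo 0 T ×ˢ univ) :=
    hA.mono (prod_mono Ioo_subset_Ico_self le_rfl)
  have hid : ∀ t₁ t₂ : ℝ, 0 < t₁ → t₁ ≤ t₂ → t₂ < T →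
      En t₂ - En t₁ = -2 * ∫ s in t₁..t₂, ∫ y in Q, ∑ j, ‖divCurvature (A s) y (𝔟 j)‖ ^ 2 :=
    fun t₁ t₂ h1 h12 h2 => ymEnergy_cell_sub_eq_of_flow_on hL a isOpen_Ioo hA'
      (WithTop.coe_le_coe.mpr le_top) (fun s hs => hper s hs.1.le hs.2)
      (fun s hs => hval s hs.1 hs.2) (fun s hs => hpde s hs.1 hs.2) h12
      (fun s hs => ⟨h1.trans_le hs.1, hs.2.trans_lt h2⟩)
  have hdis_nonneg : ∀ t₁ t₂ : ℝ, t₁ ≤ t₂ →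
      0 ≤ ∫ s in t₁..t₂, ∫ y in Q, ∑ j, ‖divCurvature (A s) y (𝔟 j)‖ ^ 2 := fun t₁ t₂ h12 =>
    intervalIntegral.integral_nonneg h12 fun s _ =>
      integral_nonneg fun y => Finset.sum_nonneg fun j _ => by positivity
  have hmono : ∀ t₁ t₂ : ℝ, 0 < t₁ → t₁ ≤ t₂ → t₂ < T → En t₂ ≤ En t₁ := by
    intro t₁ t₂ h1 h12 h2
    have h := hid t₁ t₂ h1 h12 h2
    linarith [hdis_nonneg t₁ t₂ h12]
  have hEn_nonneg : ∀ t, 0 ≤ En t := fun t => integral_nonneg fun y => ymDensityOfBasis_nonneg _ _ _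
  -- the cell is compact
  have hQc : IsCompact Q :=
    (PiLp.continuousLinearEquiv 2 ℝ (fun _ : Fin (k + 1) => ℝ)).toHomeomorph.isCompact_preimage.mpr
      isCompact_Icc
  -- a bound on `[0, T/2]` by continuity
  have hcont := continuousOn_ymDensityOfBasis_joint_Ico 𝔟 hA
  have hK : IsCompact (Icc 0 (T / 2) ×ˢ Q) := isCompact_Icc.prod hQc
  have hKsub : Icc 0 (T / 2) ×ˢ Q ⊆ Ico 0 T ×ˢ (univ : Set (EuclideanSpace ℝ (Fin (k + 1)))) :=
    prod_mono (fun t ht => ⟨ht.1, ht.2.trans_lt (by linarith)⟩) (subset_univ _)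
  obtain ⟨M₀, hM₀⟩ := hK.exists_bound_of_continuousOn (hcont.mono hKsub)
  have hvol : volume Q < ⊤ := hQc.measure_lt_top
  have hEarly : ∀ t ∈ Icc 0 (T / 2), En t ≤ M₀ * (volume Q).toReal := by
    intro t ht
    have h := norm_setIntegral_le_of_norm_le_const hvol
      (f := fun y => ymDensityOfBasis 𝔟 (A t) y) (fun y hy => hM₀ (t, y) ⟨ht, hy⟩)
    exact (Real.le_norm_self _).trans h
  -- the bound on `[0, T)`
  have hbound : ∀ t ∈ Ico 0 T, En t ≤ M₀ * (volume Q).toReal := by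
    intro t ht
    by_cases h : t ≤ T / 2
    · exact hEarly t ⟨ht.1, h⟩
    · have hT2 : 0 < T / 2 := by positivity
      exact (hmono (T / 2) t hT2 (not_le.1 h).le ht.2).trans (hEarly (T / 2) ⟨hT2.le, le_rfl⟩)
  refine ⟨⟨M₀ * (volume Q).toReal, hbound⟩, ⟨M₀ * (volume Q).toReal, ?_⟩⟩
  intro t₁ t₂ h1 h12 h2
  have h := hid t₁ t₂ h1 h12 h2
  have hb := hbound t₁ ⟨h1.le, lt_of_le_of_lt h12 h2⟩
  linarith [hEn_nonneg t₂]

/-! ### The named fact from semilinear parabolic theory and Waldron's Thm. 1.1 verbatim -/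

/-- **`Waldron2019_yangMillsFlow_flatTorus` from semilinear parabolic well-posedness and
Waldron's Thm. 1.1 taken verbatim.** The two hypotheses are the two parabolic theorems on which
the whole formalization now rests:
* `hSL` — local well-posedness of semilinear heat systems `∂ₜ u = Σᵢ ∂ᵢ∂ᵢ u + f(x, u, ∂u)` on
  the flat torus with smooth periodic data (Taylor, *PDE III*, Ch. 15, §1), as a schema over the
  finite-dimensional coefficient algebra, an invariant subspace of values and smooth periodic
  nonlinearities — from which short-time existence for the Yang–Mills heat flow is PROVED by the
  DeTurck trick (`shortTime_of_semilinearHeat`, `YangMillsHeatFlowDeTurck.lean`);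
* `hW` — **Waldron 2019, Thm. 1.1** for the trivial `U(N)`-bundle over the flat torus `ℝ⁴/Lℤ⁴`,
  with its hypothesis (1.1) — `sup_{0 ≤ t < T} ∫_M |F(t)|² + ∫₀ᵀ ∫_M |D^*F|² < ∞`, here: the
  energy of the period cell `[0, L]⁴` is bounded on `[0, T)` and the space-time dissipation
  `2 ∫_{t₁}^{t₂} ∫ ∑ⱼ ‖(div_A F)_j‖²` is bounded uniformly in `0 < t₁ ≤ t₂ < T` — and its
  conclusion "`lim_{t → T} A(t)` exists in `C^∞_loc`" (a smooth `A_T` to which all spatial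
  derivatives converge locally uniformly as `t ↑ T`).
Hypothesis (1.1) is discharged by the energy identity on finite slabs
(`energyHypothesis_of_classical`: "Over a closed manifold, (1.1) is immediate from the global
energy identity", Waldron p. 3), the smooth extension to `[0, T]` is
`contDiffOn_Icc_of_smoothLimit`, and Cor. 1.2 (restart, junction, maximal solutions) and the
passage to flow lines are `Waldron2019_yangMillsFlow_flatTorus_of_shortTime_of_smoothLimit`.
[cite: Waldron2019, §1 (1.1), Thm. 1.1, Cor. 1.2, p. 3] [cite: TaylorPDEIII2011, Ch. 15, §1]
[cite: DonaldsonKronheimer1990, §6.3.1] [cite: Struwe1994, §4.1] -/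
theorem Waldron2019_yangMillsFlow_flatTorus_of_semilinearHeat_of_thm11
    (hSL : ∀ {𝔸 : Type} [NormedRing 𝔸] [NormedAlgebra ℝ 𝔸] [FiniteDimensional ℝ 𝔸]
      (𝔤 : Submodule ℝ 𝔸) (L : ℝ), 0 < L →
      ∀ f : EuclideanSpace ℝ (Fin 4) × (EuclideanSpace ℝ (Fin 4) →L[ℝ] 𝔸) ×
          (EuclideanSpace ℝ (Fin 4) →L[ℝ] EuclideanSpace ℝ (Fin 4) →L[ℝ] 𝔸) →
          (EuclideanSpace ℝ (Fin 4) →L[ℝ] 𝔸),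
        ContDiff ℝ ∞ f →
        (∀ (x : EuclideanSpace ℝ (Fin 4)) (i : Fin 4) (a : EuclideanSpace ℝ (Fin 4) →L[ℝ] 𝔸)
            (p : EuclideanSpace ℝ (Fin 4) →L[ℝ] EuclideanSpace ℝ (Fin 4) →L[ℝ] 𝔸),
          f (x + EuclideanSpace.single i L, a, p) = f (x, a, p)) →
        (∀ (x : EuclideanSpace ℝ (Fin 4)) (a : EuclideanSpace ℝ (Fin 4) →L[ℝ] 𝔸)
            (p : EuclideanSpace ℝ (Fin 4) →L[ℝ] EuclideanSpace ℝ (Fin 4) →L[ℝ] 𝔸),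
          (∀ v, a v ∈ 𝔤) → (∀ u v, p u v ∈ 𝔤) → ∀ v, f (x, a, p) v ∈ 𝔤) →
        ∀ u₀ : Connection (EuclideanSpace ℝ (Fin 4)) 𝔸, IsSmoothConnection u₀ →
          u₀.IsValuedIn 𝔤 → u₀.IsLatticePeriodic L →
          ∃ ε : ℝ, 0 < ε ∧ ∃ u : ℝ → Connection (EuclideanSpace ℝ (Fin 4)) 𝔸,
            u 0 = u₀ ∧
            ContDiffOn ℝ ∞ (fun p : ℝ × EuclideanSpace ℝ (Fin 4) => u p.1 p.2) (Ico 0 ε ×ˢ univ) ∧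
            (∀ t : ℝ, 0 ≤ t → t < ε → (u t).IsLatticePeriodic L) ∧
            (∀ t : ℝ, 0 ≤ t → t < ε → (u t).IsValuedIn 𝔤) ∧
            ∀ t : ℝ, 0 < t → t < ε → ∀ x v : EuclideanSpace ℝ (Fin 4),
              deriv (fun s => u s x v) t =
                (∑ i, fderiv ℝ (fderiv ℝ (u t)) x (stdOrthonormalBasis ℝ (EuclideanSpace ℝ (Fin 4)) i)
                  (stdOrthonormalBasis ℝ (EuclideanSpace ℝ (Fin 4)) i)) v +
                f (x, u t x, fderiv ℝ (u t) x) v)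
    (hW : ∀ (N : ℕ) (L : ℝ), 0 < L → ∀ T : ℝ, 0 < T →
      ∀ B : ℝ → Connection (EuclideanSpace ℝ (Fin 4)) (Matrix (Fin N) (Fin N) ℂ),
        ContDiffOn ℝ ∞ (fun p : ℝ × EuclideanSpace ℝ (Fin 4) => B p.1 p.2) (Ico 0 T ×ˢ univ) →
        (∀ t : ℝ, 0 ≤ t → t < T → (B t).IsLatticePeriodic L) →
        (∀ t : ℝ, 0 < t → t < T →
          (B t).IsValuedIn (skewAdjoint.submodule ℝ (Matrix (Fin N) (Fin N) ℂ))) →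
        (∀ t : ℝ, 0 < t → t < T → ∀ x v : EuclideanSpace ℝ (Fin 4),
          deriv (fun s => B s x v) t = divCurvature (B t) x v) →
        (∃ C : ℝ, ∀ t ∈ Ico 0 T,
          ∫ y in {y | WithLp.ofLp y ∈ Icc (0 : Fin 4 → ℝ) (fun i => (0 : Fin 4 → ℝ) i + L)},
            ymDensityOfBasis (EuclideanSpace.basisFun _ ℝ) (B t) y ≤ C) →
        (∃ C : ℝ, ∀ t₁ t₂ : ℝ, 0 < t₁ → t₁ ≤ t₂ → t₂ < T →
          2 * ∫ s in t₁..t₂,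
            ∫ y in {y | WithLp.ofLp y ∈ Icc (0 : Fin 4 → ℝ) (fun i => (0 : Fin 4 → ℝ) i + L)},
              ∑ j, ‖divCurvature (B s) y (EuclideanSpace.basisFun _ ℝ j)‖ ^ 2 ≤ C) →
        ∃ B_T : Connection (EuclideanSpace ℝ (Fin 4)) (Matrix (Fin N) (Fin N) ℂ),
          IsSmoothConnection B_T ∧
          ∀ n : ℕ, TendstoLocallyUniformly (fun t y => iteratedFDeriv ℝ n (B t) y)
            (iteratedFDeriv ℝ n B_T) (𝓝[<] T)) :
    Waldron2019_yangMillsFlow_flatTorus :=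
  Waldron2019_yangMillsFlow_flatTorus_of_shortTime_of_smoothLimit
    (fun N L hL A₀ hs hv hp =>
      shortTime_of_semilinearHeat (𝔸 := Matrix (Fin N) (Fin N) ℂ) (fun 𝔤 L' hL' => hSL 𝔤 L' hL')
        L hL A₀ hs hv hp)
    fun N L hL T hT B hBs hBp hBv hBpde =>
      hW N L hL T hT B hBs hBp hBv hBpde
        (energyHypothesis_of_classical hL.le (0 : Fin 4 → ℝ) hT hBs hBp hBv hBpde).1
        (energyHypothesis_of_classical hL.le (0 : Fin 4 → ℝ) hT hBs hBp hBv hBpde).2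


end TorusEnergyOn

/-! ### Coordinate Laplacian -/

section Laplacian

variable {E : Type*} [NormedAddCommGroup E] [InnerProductSpace ℝ E]
variable {F : Type*} [NormedAddCommGroup F] [NormedSpace ℝ F]

/-- **Frame independence of the flat Laplacian**: the trace `Σᵢ D²u(x)(bᵢ, bᵢ)` of the second
derivative is the same in every orthonormal frame. [folklore] -/
theorem sum_fderiv_fderiv_apply_self_eq {ι ι' : Type*} [Fintype ι] [Fintype ι']
    (b : OrthonormalBasis ι ℝ E) (c : OrthonormalBasis ι' ℝ E) (u : E → F) (x : E) :
    (∑ i, fderiv ℝ (fderiv ℝ u) x (b i) (b i)) = ∑ j, fderiv ℝ (fderiv ℝ u) x (c j) (c j) := by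
  set B : E →ₗ[ℝ] E →ₗ[ℝ] F :=
    (ContinuousLinearMap.coeLM ℝ).comp (fderiv ℝ (fderiv ℝ u) x).toLinearMap with hB
  have h := sum_apply_self_eq_of_orthonormalBasis b c B
  simpa [hB] using h

end Laplacian

section ShortTimeCoord

variable {𝔸 : Type} [NormedRing 𝔸] [NormedAlgebra ℝ 𝔸] [CompleteSpace 𝔸] [FiniteDimensional ℝ 𝔸]
  [StarRing 𝔸] [StarModule ℝ 𝔸]

/-- `shortTime_of_semilinearHeat` with the semilinear heat hypothesis stated for the **coordinate
Laplacian** `Δu = Σ_μ ∂²u/∂x_μ²` (the frame `EuclideanSpace.basisFun`), which is the same operator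
(`sum_fderiv_fderiv_apply_self_eq`). [cite: TaylorPDEIII2011, Ch. 15, §1] -/
theorem shortTime_of_semilinearHeat_coord
    (hSL : ∀ (𝔤 : Submodule ℝ 𝔸) (L : ℝ), 0 < L →
      ∀ f : EuclideanSpace ℝ (Fin 4) × (EuclideanSpace ℝ (Fin 4) →L[ℝ] 𝔸) ×
          (EuclideanSpace ℝ (Fin 4) →L[ℝ] EuclideanSpace ℝ (Fin 4) →L[ℝ] 𝔸) →
          (EuclideanSpace ℝ (Fin 4) →L[ℝ] 𝔸),
        ContDiff ℝ ∞ f →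
        (∀ (x : EuclideanSpace ℝ (Fin 4)) (i : Fin 4) (a : EuclideanSpace ℝ (Fin 4) →L[ℝ] 𝔸)
            (p : EuclideanSpace ℝ (Fin 4) →L[ℝ] EuclideanSpace ℝ (Fin 4) →L[ℝ] 𝔸),
          f (x + EuclideanSpace.single i L, a, p) = f (x, a, p)) →
        (∀ (x : EuclideanSpace ℝ (Fin 4)) (a : EuclideanSpace ℝ (Fin 4) →L[ℝ] 𝔸)
            (p : EuclideanSpace ℝ (Fin 4) →L[ℝ] EuclideanSpace ℝ (Fin 4) →L[ℝ] 𝔸),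
          (∀ v, a v ∈ 𝔤) → (∀ u v, p u v ∈ 𝔤) → ∀ v, f (x, a, p) v ∈ 𝔤) →
        ∀ u₀ : Connection (EuclideanSpace ℝ (Fin 4)) 𝔸, IsSmoothConnection u₀ →
          u₀.IsValuedIn 𝔤 → u₀.IsLatticePeriodic L →
          ∃ ε : ℝ, 0 < ε ∧ ∃ u : ℝ → Connection (EuclideanSpace ℝ (Fin 4)) 𝔸,
            u 0 = u₀ ∧
            ContDiffOn ℝ ∞ (fun p : ℝ × EuclideanSpace ℝ (Fin 4) => u p.1 p.2) (Ico 0 ε ×ˢ univ) ∧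
            (∀ t : ℝ, 0 ≤ t → t < ε → (u t).IsLatticePeriodic L) ∧
            (∀ t : ℝ, 0 ≤ t → t < ε → (u t).IsValuedIn 𝔤) ∧
            ∀ t : ℝ, 0 < t → t < ε → ∀ x v : EuclideanSpace ℝ (Fin 4),
              deriv (fun s => u s x v) t =
                (∑ i, fderiv ℝ (fderiv ℝ (u t)) x (EuclideanSpace.basisFun (Fin 4) ℝ i)
                  (EuclideanSpace.basisFun (Fin 4) ℝ i)) v +
                f (x, u t x, fderiv ℝ (u t) x) v)
    (L : ℝ) (hL : 0 < L) (A₀ : Connection (EuclideanSpace ℝ (Fin 4)) 𝔸)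
    (hs : IsSmoothConnection A₀) (hv : A₀.IsValuedIn (skewAdjoint.submodule ℝ 𝔸))
    (hp : A₀.IsLatticePeriodic L) :
    ∃ ε : ℝ, 0 < ε ∧ ∃ A : ℝ → Connection (EuclideanSpace ℝ (Fin 4)) 𝔸,
      A 0 = A₀ ∧
      ContDiffOn ℝ ∞ (fun p : ℝ × EuclideanSpace ℝ (Fin 4) => A p.1 p.2) (Ico 0 ε ×ˢ univ) ∧
      (∀ t : ℝ, 0 ≤ t → t < ε → (A t).IsLatticePeriodic L) ∧
      (∀ t : ℝ, 0 < t → t < ε → (A t).IsValuedIn (skewAdjoint.submodule ℝ 𝔸)) ∧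
      ∀ t : ℝ, 0 < t → t < ε → ∀ x v : EuclideanSpace ℝ (Fin 4),
        deriv (fun s => A s x v) t = divCurvature (A t) x v := by
  refine shortTime_of_semilinearHeat (𝔸 := 𝔸) ?_ L hL A₀ hs hv hp
  intro 𝔤 L' hL' f hf hfp hfg u₀ hu₀ hu₀v hu₀p
  obtain ⟨ε, hε, u, hu0, hus, hup, huv, hupde⟩ := hSL 𝔤 L' hL' f hf hfp hfg u₀ hu₀ hu₀v hu₀p
  refine ⟨ε, hε, u, hu0, hus, hup, huv, fun t ht0 ht x v => ?_⟩
  rw [hupde t ht0 ht x v, sum_fderiv_fderiv_apply_self_eq (EuclideanSpace.basisFun (Fin 4) ℝ)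
    (stdOrthonormalBasis ℝ (EuclideanSpace ℝ (Fin 4))) (u t) x]

end ShortTimeCoord

section TorusCoord

open scoped Matrix.Norms.Frobenius


/-- **The named fact from semilinear parabolic well-posedness (coordinate Laplacian) and Waldron's
Thm. 1.1 verbatim** — `Waldron2019_yangMillsFlow_flatTorus_of_semilinearHeat_of_thm11` with the
semilinear heat systems written with the coordinate Laplacian `Δu = Σ_μ ∂²u/∂x_μ²`
(`EuclideanSpace.basisFun`), the same operator as the trace of `D²u` in any orthonormal frame
(`sum_fderiv_fderiv_apply_self_eq`). [cite: Waldron2019, §1 (1.1), Thm. 1.1, Cor. 1.2, p. 3]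
[cite: TaylorPDEIII2011, Ch. 15, §1] [cite: Struwe1994, §4.1] -/
theorem Waldron2019_yangMillsFlow_flatTorus_of_semilinearHeatCoord_of_thm11
    (hSL : ∀ {𝔸 : Type} [NormedRing 𝔸] [NormedAlgebra ℝ 𝔸] [FiniteDimensional ℝ 𝔸]
      (𝔤 : Submodule ℝ 𝔸) (L : ℝ), 0 < L →
      ∀ f : EuclideanSpace ℝ (Fin 4) × (EuclideanSpace ℝ (Fin 4) →L[ℝ] 𝔸) ×
          (EuclideanSpace ℝ (Fin 4) →L[ℝ] EuclideanSpace ℝ (Fin 4) →L[ℝ] 𝔸) →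
          (EuclideanSpace ℝ (Fin 4) →L[ℝ] 𝔸),
        ContDiff ℝ ∞ f →
        (∀ (x : EuclideanSpace ℝ (Fin 4)) (i : Fin 4) (a : EuclideanSpace ℝ (Fin 4) →L[ℝ] 𝔸)
            (p : EuclideanSpace ℝ (Fin 4) →L[ℝ] EuclideanSpace ℝ (Fin 4) →L[ℝ] 𝔸),
          f (x + EuclideanSpace.single i L, a, p) = f (x, a, p)) →
        (∀ (x : EuclideanSpace ℝ (Fin 4)) (a : EuclideanSpace ℝ (Fin 4) →L[ℝ] 𝔸)
            (p : EuclideanSpace ℝ (Fin 4) →L[ℝ] EuclideanSpace ℝ (Fin 4) →L[ℝ] 𝔸),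
          (∀ v, a v ∈ 𝔤) → (∀ u v, p u v ∈ 𝔤) → ∀ v, f (x, a, p) v ∈ 𝔤) →
        ∀ u₀ : Connection (EuclideanSpace ℝ (Fin 4)) 𝔸, IsSmoothConnection u₀ →
          u₀.IsValuedIn 𝔤 → u₀.IsLatticePeriodic L →
          ∃ ε : ℝ, 0 < ε ∧ ∃ u : ℝ → Connection (EuclideanSpace ℝ (Fin 4)) 𝔸,
            u 0 = u₀ ∧
            ContDiffOn ℝ ∞ (fun p : ℝ × EuclideanSpace ℝ (Fin 4) => u p.1 p.2) (Ico 0 ε ×ˢ univ) ∧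
            (∀ t : ℝ, 0 ≤ t → t < ε → (u t).IsLatticePeriodic L) ∧
            (∀ t : ℝ, 0 ≤ t → t < ε → (u t).IsValuedIn 𝔤) ∧
            ∀ t : ℝ, 0 < t → t < ε → ∀ x v : EuclideanSpace ℝ (Fin 4),
              deriv (fun s => u s x v) t =
                (∑ i, fderiv ℝ (fderiv ℝ (u t)) x (EuclideanSpace.basisFun (Fin 4) ℝ i)
                  (EuclideanSpace.basisFun (Fin 4) ℝ i)) v +
                f (x, u t x, fderiv ℝ (u t) x) v)
    (hW : ∀ (N : ℕ) (L : ℝ), 0 < L → ∀ T : ℝ, 0 < T →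
      ∀ B : ℝ → Connection (EuclideanSpace ℝ (Fin 4)) (Matrix (Fin N) (Fin N) ℂ),
        ContDiffOn ℝ ∞ (fun p : ℝ × EuclideanSpace ℝ (Fin 4) => B p.1 p.2) (Ico 0 T ×ˢ univ) →
        (∀ t : ℝ, 0 ≤ t → t < T → (B t).IsLatticePeriodic L) →
        (∀ t : ℝ, 0 < t → t < T →
          (B t).IsValuedIn (skewAdjoint.submodule ℝ (Matrix (Fin N) (Fin N) ℂ))) →
        (∀ t : ℝ, 0 < t → t < T → ∀ x v : EuclideanSpace ℝ (Fin 4),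
          deriv (fun s => B s x v) t = divCurvature (B t) x v) →
        (∃ C : ℝ, ∀ t ∈ Ico 0 T,
          ∫ y in {y | WithLp.ofLp y ∈ Icc (0 : Fin 4 → ℝ) (fun i => (0 : Fin 4 → ℝ) i + L)},
            ymDensityOfBasis (EuclideanSpace.basisFun _ ℝ) (B t) y ≤ C) →
        (∃ C : ℝ, ∀ t₁ t₂ : ℝ, 0 < t₁ → t₁ ≤ t₂ → t₂ < T →
          2 * ∫ s in t₁..t₂,
            ∫ y in {y | WithLp.ofLp y ∈ Icc (0 : Fin 4 → ℝ) (fun i => (0 : Fin 4 → ℝ) i + L)},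
              ∑ j, ‖divCurvature (B s) y (EuclideanSpace.basisFun _ ℝ j)‖ ^ 2 ≤ C) →
        ∃ B_T : Connection (EuclideanSpace ℝ (Fin 4)) (Matrix (Fin N) (Fin N) ℂ),
          IsSmoothConnection B_T ∧
          ∀ n : ℕ, TendstoLocallyUniformly (fun t y => iteratedFDeriv ℝ n (B t) y)
            (iteratedFDeriv ℝ n B_T) (𝓝[<] T)) :
    Waldron2019_yangMillsFlow_flatTorus :=
  Waldron2019_yangMillsFlow_flatTorus_of_shortTime_of_smoothLimit
    (fun N L hL A₀ hs hv hp =>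
      shortTime_of_semilinearHeat_coord (𝔸 := Matrix (Fin N) (Fin N) ℂ)
        (fun 𝔤 L' hL' => hSL 𝔤 L' hL') L hL A₀ hs hv hp)
    fun N L hL T hT B hBs hBp hBv hBpde =>
      hW N L hL T hT B hBs hBp hBv hBpde
        (energyHypothesis_of_classical hL.le (0 : Fin 4 → ℝ) hT hBs hBp hBv hBpde).1
        (energyHypothesis_of_classical hL.le (0 : Fin 4 → ℝ) hT hBs hBp hBv hBpde).2

end TorusCoord


end Literature.MathematicalPhysics.QuantumLattice
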